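import Summits.CriticalPhenomena.PercolationContinuityZ3.Theorems.Transplant.SkelPhiParamsCells
import Summits.CriticalPhenomena.PercolationContinuityZ3.Theorems.Transplant.SkelPhiParamsAcc
import Summits.CriticalPhenomena.PercolationContinuityZ3.Theorems.Transplant.SkelNegParamsCoarse
import HarnessLib

/-!
# N1 params, part 1 (q-free toolkit, consumer-independent): THE CELL CONSTANT `K ≡ 0 mod 40`, THE ONE-UNIT CELLS `⟨K, 1⟩`, THE ACCURACY BUDGET,
# AND THE KIT SCALARS OF THE {±1} NODE — one SQUARE of half-width `As := pgScale n_s h_s (3ℓ_s)` (the φ-bounding square of the short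
# parallelogram link region) in place of D″'s two rectangles `StepI.widths D.Gb D.Fb I (M_u+1)` — with the constants-only slab/shell rooms of a
# `Skelφ.kitClause'`-shaped consumer discharged for them (`Skelφ.NegPrm.*`, twin of `Skelφ.Prm.*`, SkelPhiParamsKit p251189)

builds on p205010 (kernel theorem, internal audit signed; external expert review pending) — nothing in this file uses p205010.
Status sentence (coordinator 2026-08-20T04:30Z): "θ(p_c) = 0 on ℤ^d, all d ≥ 2 — kernel-verified (Lean 4/Mathlib, standard axioms); internal adversarial
audit SIGNED 2026-08-20 04:29Z; external expert review pending."
Lane `prim-bschramm-*`, seat `prim-bschramm-stmt` (gen 12); helper file (`--supports stmt-CriticalPhenomena-4575 --as helper`); ledger HOME/prim-bschramm-stmt/NEG-PARAMS.md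
v0.5 §0 (n1) (cell constant, cells, accuracies), (n4)′ (the short width is `R′`-free), (n7) (kit block = ONE square, hp-8 g31 Q1 answer, lane INBOX :1388),
(n5)(iii)(v) (floor wiring), §3.  Everything here is ℕ-arithmetic on numbers handed by the closure (`K₀`), by Step I″ (the fat radius `R = D.R` as a
FUNCTION, the zone scale `M_u`, the seed depth `ρz`, the short equilibrium data `n_s, h_s, ℓ_s`) and by the skeleton (`G φ types` for the frame-uniform
comparison radii); nothing depends on the shape of `StepI.DataN` (ledger V0) nor on the running density, so the file lands before (L0-4).
* §1 `NegPrm.Kq K₀ := Kof K₀ / 40 + 1` (one stride in coarse units), **`NegPrm.Kcell K₀ := 40·Kq K₀`** (`Kof K₀ < Kcell ≤ Kof K₀ + 40`, `40 ∣ Kcell`),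
  **`NegPrm.cells K₀ : PCells2 := ⟨Kcell K₀, 1⟩`** (`r_i = rmax = Kcell`), the accuracy budget `Prm.nmax 0 = 1000 ≥ 880, 481` (so the N1 kit accuracy is
  `Prm.δkit G hΔ κ 0`, no new definition: `δkit₀_le_δr`, `δkit₀_le_δUP` for every length `≤ 1000`);
* §2 the kit scalars: `As`, `Akit := fun _ _ => As` / `Rkit := fun _ => R As` (the `A`/`Rk` slots of a `kitClause'`-shaped consumer), the clamp = seed-slab
  scale `Mk := max (M_u+1) As`, the kit depth `Kd`, the face-count bound `cU`, the seed-slab radius `Rseed`, the shell radius `rs`; the kit REGION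
  `pgramPrism c n_s h_s (3ℓ_s) (R As) ⊆ cylBall c As (R As)`;
* §3 the sixteen constants-only binders (`hℓs hA hAℓ hK hnA hnM hρK hR'₁ hR'₂ hr₀₁ hr₀₂ hrs₁ hrs₂ hcU`, `tanOff_Mk`, `Rseed_le_rs`) at
  `(ℓs := Mk, M := Mk, A := Akit, Rk := Rkit, K := Kd, R' := Rseed, r₀ := rs, rs, n := M_u, ρ := ρz)`;
* §4 floor wiring: the (R) clearance floor through `nL`'s first slot (`le_nL_of_le_slot`, `rootClear_le_nL`), and the hypotheses `4K·R′ + 2 ≤ M_L`,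
  `4K + 2 ≤ M_L` of `SkelNegParamsCoarse` (p267342) from the ledger floor `ML … (4K) R′ …` (`kit_floor_of_ML`).
ORDER NOTE (v0.5, forced by the one-square kit): `As ≥ n_s > M_u`, so `Mk = As`, `T₀ = 3·Mk + 2 > n_s` and `R′ = T₀ + Lcnt + 1 > n_s` — the kit LEVELS sit
ABOVE the short scale; hence `n_s` carries NO `R′` floor (the `R′` slot of `NegPrm.nS` is instantiated at `0`) and every `R′` floor lives in `M_L` (n5).
[cite: KozmaNitzan2024, §4 Theorem 6 (pp. 25–31): the order of constants; Lemma 10 Steps III–V (pp. 19–22)] [cite: MartineauTassion2017, Lem. 3.5]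
-/

namespace Summit.CriticalPhenomena.PercolationContinuityZ3.Theorems.Transplant

namespace Skelφ

namespace NegPrm

open Literature.Probability.Percolation Literature.Probability.LatticeModels SimpleGraph
open SkelI (tanOff)
open BoxProdZ2 (Kof twenty_le_Kof le_Kof)
open SkelConc (Consts)
open Literature.Probability.Percolation.KozmaNitzan.Cells (oth)

/-! ## §1 Before Step I″: the cell constant, the one-unit cells, the accuracy budget -/

/-- **One stride in coarse units** `Kq K₀ := Kof K₀ / 40 + 1` (`A″ = 40` strides per cell unit; one stride = `K/A″ = Kq` ρ-units). [this work] -/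
def Kq (K₀ : ℕ) : ℕ := Kof K₀ / 40 + 1

/-- **The cell constant** `K := 40·(Kof K₀ / 40 + 1)` — the least multiple of `A″ = 40` above `Kof K₀ = max 20 K₀`, so that stride corners are integers in
ρ-units (hp-8 g31, lane INBOX 2026-08-21T12:10:15Z; NEG-PARAMS (n1)). [this work] -/
def Kcell (K₀ : ℕ) : ℕ := 40 * Kq K₀

/-- `Kcell` unfolded. [folklore] -/
theorem Kcell_eq (K₀ : ℕ) : Kcell K₀ = 40 * (Kof K₀ / 40 + 1) := rfl

/-- `1 ≤ Kq`. [folklore] -/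
theorem one_le_Kq (K₀ : ℕ) : 1 ≤ Kq K₀ := Nat.le_add_left 1 _

/-- `Kof K₀ < Kcell K₀` (`40·(x/40 + 1) > x`). [folklore] -/
theorem Kof_lt_Kcell (K₀ : ℕ) : Kof K₀ < Kcell K₀ := by unfold Kcell Kq; omega

/-- `Kof K₀ ≤ Kcell K₀`. [folklore] -/
theorem Kof_le_Kcell (K₀ : ℕ) : Kof K₀ ≤ Kcell K₀ := (Kof_lt_Kcell K₀).le

/-- `K₀ ≤ Kcell K₀` (the closure's `κ.K₀ ≤ K` for `WFHolds`). [folklore] -/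
theorem K₀_le_Kcell (K₀ : ℕ) : K₀ ≤ Kcell K₀ := (le_Kof K₀).trans (Kof_le_Kcell K₀)

/-- `Kcell K₀ ≤ Kof K₀ + 40`. [folklore] -/
theorem Kcell_le (K₀ : ℕ) : Kcell K₀ ≤ Kof K₀ + 40 := by unfold Kcell Kq; omega

/-- `40 ≤ Kcell K₀` (in particular `20 ≤ Kcell`, `1 ≤ Kcell`). [folklore] -/
theorem forty_le_Kcell (K₀ : ℕ) : 40 ≤ Kcell K₀ ∧ 20 ≤ Kcell K₀ ∧ 1 ≤ Kcell K₀ := by unfold Kcell Kq; omega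

/-- `40 ∣ Kcell K₀` and `Kcell K₀ / 40 = Kq K₀` (one stride is the INTEGER `K/40` coarse units). [folklore] -/
theorem forty_dvd_Kcell (K₀ : ℕ) : 40 ∣ Kcell K₀ ∧ Kcell K₀ / 40 = Kq K₀ ∧ Kcell K₀ = 40 * Kq K₀ :=
  ⟨Dvd.intro _ rfl, by unfold Kcell; omega, rfl⟩

/-- **The one-unit planar cells of N1** `⟨K, s := 1⟩` over the coarse dual skeleton `ρ ∘ φ` (hp-8 D1 / P5-R2: `r_i = K` ρ-units, no unit pair).
[cite: KozmaNitzan2024, §4 pp. 25–26 (the cells)] -/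
def cells (K₀ : ℕ) : PCells2 := ⟨Kcell K₀, fun _ => 1, (forty_le_Kcell K₀).2.1, fun _ => le_rfl⟩

/-- The cells' `K` is `Kcell K₀`. [folklore] -/
theorem cells_K (K₀ : ℕ) : (cells K₀).K = Kcell K₀ := rfl

/-- The cells' stub increments are `1`. [folklore] -/
theorem cells_s (K₀ : ℕ) (i : Fin 2) : (cells K₀).s i = 1 := rfl

/-- The cells' units are `r_i = Kcell K₀` on both axes. [folklore] -/
theorem cells_r (K₀ : ℕ) (i : Fin 2) : (cells K₀).r i = Kcell K₀ := by
  simp only [PCells2.r, cells_K, cells_s, Nat.mul_one]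

/-- `rmax = Kcell K₀`. [folklore] -/
theorem cells_rmax (K₀ : ℕ) : (cells K₀).rmax = Kcell K₀ := by
  simp only [PCells2.rmax, cells_r, max_self]

/-- `κ.K₀ ≤ (cells κ.K₀).K` (the `WFHolds` clause). [folklore] -/
theorem K₀_le_cells_K (K₀ : ℕ) : K₀ ≤ (cells K₀).K := K₀_le_Kcell K₀

/-- **The accuracy budget of N1 is `Prm.nmax 0 = 1000`**: it covers the (F) inner runs (`n_F = 880`) and the (R) root run (`N_R + 1 ≤ 481`), so the
N1 kit accuracy is `Prm.δkit G hΔ κ 0` and the Step-I″ accuracy `Prm.δI G hΔ κ 0` (no new definition; the (C) corridors `≤ nmaxN = 2000` are served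
by the closure-handed `κ.δ`, NEG-PARAMS (n0)). [this work] -/
theorem budget_le_nmax : 880 ≤ Prm.nmax 0 ∧ 481 ≤ Prm.nmax 0 ∧ Prm.nmax 0 = 1000 := by unfold Prm.nmax; omega

section Acc

variable {V : Type} [DecidableEq V] [Countable V] (G : SimpleGraph V) [G.LocallyFinite] {Δ : ℕ} (hΔ : ∀ v, G.degree v ≤ Δ)

/-- `δkit₀ ≤ κ.δr n` for every root-run length `n ≤ 1000`. [folklore] -/
theorem δkit₀_le_δr (κ : Consts) {n : ℕ} (hn : n ≤ 1000) : Prm.δkit G hΔ κ 0 ≤ κ.δr n :=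
  Prm.δkit_le_δr G hΔ κ 0 (by unfold Prm.nmax; omega)

/-- `δkit₀ ≤ δUP n (δ₂²)` for every inner-chain length `n ≤ 1000`. [folklore] -/
theorem δkit₀_le_δUP (κ : Consts) {n : ℕ} (hn : n ≤ 1000) : Prm.δkit G hΔ κ 0 ≤ δUP G hΔ n (κ.δ₂ ^ 2) :=
  Prm.δkit_le_δUP G hΔ κ 0 (by unfold Prm.nmax; omega)

end Acc

/-! ## §2 After Step I″: the kit scalars (ONE square at the short scale) -/

section Kit

variable (R : ℕ → ℕ) (Mu ns : ℕ) (hs : ℤ) (ls ρz : ℕ)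

/-- **The kit square half-width** `As := pgScale n_s h_s (3ℓ_s) = max n_s (3ℓ_s + |h_s|)` — the φ-bounding square of the short parallelogram link region
`pgramPrism c n_s h_s (3ℓ_s) …` (hp-8 g31 Q1: both `A I i` of the D″ kit block become this one number). [this work] -/
def As (ns : ℕ) (hs : ℤ) (ls : ℕ) : ℕ := topScale ns hs ls

/-- `As = pgScale n_s h_s (3ℓ_s)`. [folklore] -/
theorem As_eq : As ns hs ls = pgScale ns hs (3 * ls) := rfl

/-- `n_s ≤ As`. [folklore] -/
theorem ns_le_As : ns ≤ As ns hs ls := nL_le_topScale ns hs ls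

/-- `3ℓ_s + |h_s| ≤ As`. [folklore] -/
theorem height_le_As : 3 * ls + hs.natAbs ≤ As ns hs ls := height_le_topScale ns hs ls

/-- **The `A` slot**: the kit "rectangles" are one square, `Akit I i := As` for both families `I` and both coordinates `i`. [this work] -/
def Akit (ns : ℕ) (hs : ℤ) (ls : ℕ) : Fin 2 → Fin 2 → ℕ := fun _ _ => As ns hs ls

/-- **The `Rk` slot**: `Rkit I := R As` (the fat radius of the kit square). [this work] -/
def Rkit (R : ℕ → ℕ) (ns : ℕ) (hs : ℤ) (ls : ℕ) : Fin 2 → ℕ := fun _ => R (As ns hs ls)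

/-- `Akit I i = As`. [folklore] -/
@[simp] theorem Akit_apply (I i : Fin 2) : Akit ns hs ls I i = As ns hs ls := rfl

/-- `Rkit I = R As`. [folklore] -/
@[simp] theorem Rkit_apply (I : Fin 2) : Rkit R ns hs ls I = R (As ns hs ls) := rfl

/-- `amax (Akit I) = As`. [folklore] -/
theorem amax_Akit (I : Fin 2) : amax (Akit ns hs ls I) = As ns hs ls := by simp [amax]

/-- `hRk`-shape: `Rkit I = R (amax (Akit I))`. [folklore] -/
theorem Rkit_eq_amax (I : Fin 2) : Rkit R ns hs ls I = R (amax (Akit ns hs ls I)) := by rw [amax_Akit]; rfl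

/-- **The clamp scale = seed-slab half-width** `Mk := max (M_u + 1) As` (dominates the kit half-width; equals `As` whenever `M_u + 1 ≤ n_s`). [this work] -/
def Mk (Mu ns : ℕ) (hs : ℤ) (ls : ℕ) : ℕ := max (Mu + 1) (As ns hs ls)

/-- **The kit depth** `Kd ρz := Mk + 1 + Mk + max (R As) ρz` (the `K` of `kitClause'`, NOT the cell constant). [this work] -/
def Kd (R : ℕ → ℕ) (Mu ns : ℕ) (hs : ℤ) (ls ρz : ℕ) : ℕ := Mk Mu ns hs ls + 1 + Mk Mu ns hs ls + max (R (As ns hs ls)) ρz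

/-- **The face-count bound** `cU Δ := (Δ+1)^{R As}`. [this work] -/
def cU (R : ℕ → ℕ) (ns : ℕ) (hs : ℤ) (ls Δ : ℕ) : ℕ := (Δ + 1) ^ R (As ns hs ls)

/-- **THE KIT REGION LIES IN THE FAT SQUARE OF ITS SCALE**: `pgramPrism c n_s h_s (3ℓ_s) (R As) ⊆ cylBall c As (R As)` (so the square-prism devices —
fat/excess radii, `cylRadMax`, the slab rooms below — apply to the parallelogram kit verbatim). [folklore] -/
theorem kitRegion_subset_cylBall {V : Type} (G : SimpleGraph V) (φ : V → Site 2) (c : V) :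
    pgramPrism G φ c ns hs (3 * ls) (R (As ns hs ls)) ⊆ cylBall G φ c (As ns hs ls) (R (As ns hs ls)) :=
  pgramPrism_subset_cylBall G φ c ns hs (3 * ls) _

variable {V : Type} (G : SimpleGraph V) [G.LocallyFinite] (φ : V → Site 2) (types : Finset V)

/-- **The seed-slab radius** `Rseed := max (cylRadMax Mk (Mk + 2 + 2·T₀)) (cylRadMax Mk (Mk + 2 + As + R As))` (frame-uniform comparison radii; the `R'`
of `kitClause'`, NOT the band growth). [this work] -/
noncomputable def Rseed : ℕ :=
  max (cylRadMax G φ types (Mk Mu ns hs ls) (Mk Mu ns hs ls + 2 + 2 * tanOff (Mk Mu ns hs ls) (Mk Mu ns hs ls)))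
    (cylRadMax G φ types (Mk Mu ns hs ls) (Mk Mu ns hs ls + 2 + As ns hs ls + R (As ns hs ls)))

/-- **The shell / near–far radius** `rs ρz := Mk + 2 + T₀ + max Rseed (Kd ρz)` (serves both `r₀` and `rs` of `kitClause'`). [this work] -/
noncomputable def rs : ℕ :=
  Mk Mu ns hs ls + 2 + tanOff (Mk Mu ns hs ls) (Mk Mu ns hs ls) + max (Rseed R Mu ns hs ls G φ types) (Kd R Mu ns hs ls ρz)

/-! ## §3 The constants-only binders of a `kitClause'`-shaped consumer -/

/-- `hℓs : 1 ≤ Mk` (indeed `M_u + 1 ≤ Mk`). [folklore] -/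
theorem one_le_Mk : 1 ≤ Mk Mu ns hs ls := le_trans (by omega) (le_max_left _ _)

/-- `M_u + 1 ≤ Mk`. [folklore] -/
theorem Mu_succ_le_Mk : Mu + 1 ≤ Mk Mu ns hs ls := le_max_left _ _

/-- `hnM : M_u ≤ Mk`. [folklore] -/
theorem hnM : Mu ≤ Mk Mu ns hs ls := le_trans (Nat.le_succ _) (Mu_succ_le_Mk Mu ns hs ls)

/-- `As ≤ Mk`. [folklore] -/
theorem As_le_Mk : As ns hs ls ≤ Mk Mu ns hs ls := le_max_right _ _

/-- `Mk = As` as soon as `M_u + 1 ≤ n_s` (always the case at the ledger's `n_s`). [folklore] -/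
theorem Mk_eq_As (h : Mu + 1 ≤ ns) : Mk Mu ns hs ls = As ns hs ls := max_eq_right (h.trans (ns_le_As ns hs ls))

/-- `hA : Akit I i ≤ Mk` for all `I i`. [folklore] -/
theorem hA (I i : Fin 2) : Akit ns hs ls I i ≤ Mk Mu ns hs ls := As_le_Mk Mu ns hs ls

/-- `hAℓ : Akit I (oth I) ≤ ℓs` with `ℓs := Mk`. [folklore] -/
theorem hAℓ (I : Fin 2) : Akit ns hs ls I (oth I) ≤ Mk Mu ns hs ls := hA Mu ns hs ls I (oth I)

/-- `hnA : M_u + 1 ≤ Akit I I` as soon as `M_u + 1 ≤ n_s`. [folklore] -/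
theorem hnA (h : Mu + 1 ≤ ns) (I : Fin 2) : Mu + 1 ≤ Akit ns hs ls I I := h.trans (ns_le_As ns hs ls)

/-- `hnA` at the ledger's short width `n_s := NegPrm.nS n₁ M_u R′ ρz` (any `R′` slot; v0.5 uses `0`): `M_u + 1 ≤ Akit I I`. [folklore] -/
theorem hnA_nS (n₁Mu R' : ℕ) (I : Fin 2) : Mu + 1 ≤ Akit (nS n₁Mu Mu R' ρz) hs ls I I :=
  hnA Mu (nS n₁Mu Mu R' ρz) hs ls (Mu_lt_nS n₁Mu Mu R' ρz) I

/-- `R As ≤ max (R As) ρz` and `ρz ≤ max (R As) ρz`. [folklore] -/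
theorem R_le_max : R (As ns hs ls) ≤ max (R (As ns hs ls)) ρz ∧ ρz ≤ max (R (As ns hs ls)) ρz := ⟨le_max_left _ _, le_max_right _ _⟩

/-- `hK : ℓs + 1 + Akit I I + Rkit I ≤ Kd ρz` (`ℓs := Mk`). [folklore] -/
theorem hK (I : Fin 2) : Mk Mu ns hs ls + 1 + Akit ns hs ls I I + Rkit R ns hs ls I ≤ Kd R Mu ns hs ls ρz := by
  have h1 := As_le_Mk Mu ns hs ls
  have h2 := (R_le_max R ns hs ls ρz).1
  simp only [Akit_apply, Rkit_apply]
  unfold Kd; omega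

/-- `hρK : ℓs + 1 + Akit I I + ρz ≤ Kd ρz`. [folklore] -/
theorem hρK (I : Fin 2) : Mk Mu ns hs ls + 1 + Akit ns hs ls I I + ρz ≤ Kd R Mu ns hs ls ρz := by
  have h1 := As_le_Mk Mu ns hs ls
  have h2 := (R_le_max R ns hs ls ρz).2
  simp only [Akit_apply]
  unfold Kd; omega

/-- `hcU : (Δ+1)^{Rkit I} ≤ cU Δ` (with equality). [folklore] -/
theorem hcU (Δ : ℕ) (I : Fin 2) : (Δ + 1) ^ Rkit R ns hs ls I ≤ cU R ns hs ls Δ := le_rfl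

/-- The clamp offset is `T₀ = 3·Mk + 2` (`tanOff M M = 2M + 2 + M`). [folklore] -/
theorem tanOff_Mk : tanOff (Mk Mu ns hs ls) (Mk Mu ns hs ls) = 3 * Mk Mu ns hs ls + 2 := by unfold tanOff; omega

/-- The kit levels sit ABOVE the short scale: `n_s < tanOff Mk Mk` (so `n_s` can carry no `R′`-floor; NEG-PARAMS v0.5 (n4)′). [folklore] -/
theorem ns_lt_tanOff : ns < tanOff (Mk Mu ns hs ls) (Mk Mu ns hs ls) := by
  have h1 := ns_le_As ns hs ls
  have h2 := As_le_Mk Mu ns hs ls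
  rw [tanOff_Mk]; omega

/-- `hR'₁ : cylRadMax ℓs (ℓs + 2 + 2·T₀) ≤ Rseed`. [folklore] -/
theorem hR'₁ : cylRadMax G φ types (Mk Mu ns hs ls) (Mk Mu ns hs ls + 2 + 2 * tanOff (Mk Mu ns hs ls) (Mk Mu ns hs ls)) ≤
    Rseed R Mu ns hs ls G φ types := le_max_left _ _

/-- `hR'₂ : cylRadMax ℓs (ℓs + 2 + Akit I I + Rkit I) ≤ Rseed`. [folklore] -/
theorem hR'₂ (I : Fin 2) : cylRadMax G φ types (Mk Mu ns hs ls) (Mk Mu ns hs ls + 2 + Akit ns hs ls I I + Rkit R ns hs ls I) ≤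
    Rseed R Mu ns hs ls G φ types := le_max_right _ _

/-- `Rseed ≤ rs` and `Kd ≤ rs` (the shell radius dominates both). [folklore] -/
theorem Rseed_le_rs : Rseed R Mu ns hs ls G φ types ≤ rs R Mu ns hs ls ρz G φ types ∧ Kd R Mu ns hs ls ρz ≤ rs R Mu ns hs ls ρz G φ types := by
  have h1 := le_max_left (Rseed R Mu ns hs ls G φ types) (Kd R Mu ns hs ls ρz)
  have h2 := le_max_right (Rseed R Mu ns hs ls G φ types) (Kd R Mu ns hs ls ρz)
  unfold rs; omega

/-- `hr₀₁ : ℓs + 1 + T₀ + Rseed ≤ rs` (with `r₀ := rs`). [folklore] -/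
theorem hr₀₁ : Mk Mu ns hs ls + 1 + tanOff (Mk Mu ns hs ls) (Mk Mu ns hs ls) + Rseed R Mu ns hs ls G φ types ≤ rs R Mu ns hs ls ρz G φ types := by
  have := le_max_left (Rseed R Mu ns hs ls G φ types) (Kd R Mu ns hs ls ρz)
  unfold rs; omega

/-- `hr₀₂ : ℓs + 2 + T₀ + Kd ≤ rs`. [folklore] -/
theorem hr₀₂ : Mk Mu ns hs ls + 2 + tanOff (Mk Mu ns hs ls) (Mk Mu ns hs ls) + Kd R Mu ns hs ls ρz ≤ rs R Mu ns hs ls ρz G φ types := by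
  have := le_max_right (Rseed R Mu ns hs ls G φ types) (Kd R Mu ns hs ls ρz)
  unfold rs; omega

/-- `hrs₁ : ℓs + 2 + T₀ + Rseed ≤ rs`. [folklore] -/
theorem hrs₁ : Mk Mu ns hs ls + 2 + tanOff (Mk Mu ns hs ls) (Mk Mu ns hs ls) + Rseed R Mu ns hs ls G φ types ≤ rs R Mu ns hs ls ρz G φ types := by
  have := le_max_left (Rseed R Mu ns hs ls G φ types) (Kd R Mu ns hs ls ρz)
  unfold rs; omega

/-- `hrs₂ : ℓs + 2 + T₀ + Kd ≤ rs`. [folklore] -/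
theorem hrs₂ : Mk Mu ns hs ls + 2 + tanOff (Mk Mu ns hs ls) (Mk Mu ns hs ls) + Kd R Mu ns hs ls ρz ≤ rs R Mu ns hs ls ρz G φ types :=
  hr₀₂ R Mu ns hs ls ρz G φ types

end Kit

/-! ## §4 Floor wiring: the (R) clearance slot of `n_L`, and the kit-drift floors of `SkelNegParamsCoarse` from `M_L` -/

/-- Anything below `nL`'s first slot is below `n_L`. [folklore] -/
theorem le_nL_of_le_slot {x n₁ML : ℕ} (h : x ≤ n₁ML) (ML K R' : ℕ) : x ≤ nL n₁ML ML K R' := h.trans (n₁_le_nL n₁ML ML K R')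

/-- **The (R) clearance floor through the first slot** (NEG-PARAMS (n5)(v), p2-g10: strides `k ≥ 2` of the root run clear the wired root cell iff
`n_L > r_A + q_R + 3R′`): with `n_L := nL (max (n₁ M_L) f) M_L K R′` both `n₁ M_L ≤ n_L` (equilibrium admissibility) and `f ≤ n_L` hold — so the
landed three-slot `NegPrm.nL` serves unchanged (`f := r_A + q_R + 3R′ + 1`). [folklore] -/
theorem rootClear_le_nL (n₁ML f ML K R' : ℕ) : n₁ML ≤ nL (max n₁ML f) ML K R' ∧ f ≤ nL (max n₁ML f) ML K R' :=
  ⟨le_nL_of_le_slot (le_max_left _ _) ML K R', le_nL_of_le_slot (le_max_right _ _) ML K R'⟩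

/-- **The kit-drift floors from `M_L`**: with the coarse slot of `NegPrm.ML` fed `4K` (ledger v0.3: `M_L := ML M_u C′ c_max (4K) R′ …`, so that
`4K(R′+2) ≤ M_L`) and `1 ≤ K`, the hypotheses of `SkelNegParamsCoarse` hold: `4K·R′ + 2 ≤ M_L` (`coarse_containment_of_floors` at `s := R′`:
`c_R′ = 1`), `4K + 2 ≤ M_L` (`lip_coarseSkel_of_floors`: ρ-Lip), and `K·R′ + 2 ≤ M_L`, `K ≤ M_L`. [folklore] -/
theorem kit_floor_of_ML {K : ℕ} (hK : 1 ≤ K) (Mu C' cmax R' hs ls ns : ℕ) :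
    4 * K * R' + 2 ≤ ML Mu C' cmax (4 * K) R' hs ls ns ∧ 4 * K + 2 ≤ ML Mu C' cmax (4 * K) R' hs ls ns ∧
      K * R' + 2 ≤ ML Mu C' cmax (4 * K) R' hs ls ns ∧ K ≤ ML Mu C' cmax (4 * K) R' hs ls ns := by
  have h := (coarse_floor_le_ML Mu C' cmax (4 * K) R' hs ls ns).1
  have e : 4 * K * (R' + 2) = 4 * K * R' + 8 * K := by ring
  rw [e] at h
  refine ⟨by omega, ?_, by nlinarith, by omega⟩
  nlinarith

/-- The same floors CAST TO `ℤ` (the shape `SkelNegParamsCoarse` consumes: `4·K·s + 2 ≤ M` over `ℤ`, at `s := R′` and `s := 1`). [folklore] -/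
theorem kit_floor_of_ML_int {K : ℕ} (hK : 1 ≤ K) (Mu C' cmax R' hs ls ns : ℕ) :
    4 * (K : ℤ) * (R' : ℤ) + 2 ≤ (ML Mu C' cmax (4 * K) R' hs ls ns : ℤ) ∧ 4 * (K : ℤ) * 1 + 2 ≤ (ML Mu C' cmax (4 * K) R' hs ls ns : ℤ) := by
  obtain ⟨h1, h2, -, -⟩ := kit_floor_of_ML hK Mu C' cmax R' hs ls ns
  constructor
  · exact_mod_cast h1
  · rw [mul_one]; exact_mod_cast h2

end NegPrm

end Skelφ

end Summit.CriticalPhenomena.PercolationContinuityZ3.Theorems.Transplant
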